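import Summits.QuantumFields.YangMills.Theorems.SwapTwistDeficitToronLogQuaternion
import Literature.MathematicalPhysics.QuantumFieldTheory.DybalskiStottmeisterTanimoto2024.DST24CriticalPoint
import Literature.MathematicalPhysics.QuantumLattice.SU2HaarSmallBall
import HarnessLib

/-!
# NEAR-COMMUTING QUATERNIONS ARE NEAR COAXIAL ONES: `∃ q′` coaxial with `p`, `re q′ = re q`, `‖q′‖² = ‖q‖²`, `‖q − q′‖ ≤ ‖pq − qp‖/‖im p‖`
# (free-hands support of ⟨stmt-QuantumFields-24197⟩ `SwapVirialDeficit.SwapGluedStiffness`; step (i)–(ii) of the NEAR-FLAT PROJECTION lemma of LEAD g98's plan of record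
# memo7 §C(c) «matching on ω-patches»: the pair lemma with the LIPSCHITZ constant `1/‖im p‖` of the heavy element)

`‖pq − qp‖² = 4·(|p⃗|²|q⃗|² − ⟨p⃗,q⃗⟩²)` (Lagrange; ✓`ToronLog.norm_comm_sq` in components), so the distance from `q⃗` to the axis `ℝp⃗` is `‖pq − qp‖/(2|p⃗|)`; rescaling the foot point
back to length `|q⃗|` at most doubles the move.  Hence:
* `norm_comm_sq_lagrange`, `normSq_im_sub_proj` (`|q⃗ − t₀p⃗|² = ‖pq−qp‖²/(4|p⃗|²)`, `t₀ = ⟨p⃗,q⃗⟩/|p⃗|²`);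
* ★★ `exists_coaxial_near (hp : p.im ≠ 0) (q)`: `∃ q′ : ℍ, q′.re = q.re ∧ (∃ t : ℝ, q′.im = t • p.im) ∧ ‖q′‖ ^ 2 = ‖q‖ ^ 2 ∧ p * q′ = q′ * p ∧ ‖q − q′‖ ≤ ‖p * q − q * p‖ / ‖p.im‖`.
(The projection `C ↦ C♭` of memo7 §C(c) applies this to every leader against the heaviest one, then fixes the σ-relations along the common axis — sequel.)

HONEST LABEL: elementary quaternion geometry; stubs of ➎, ⟨24197⟩ ∕ ⟨24194⟩ ∕ ⟨24497⟩ OPEN; own crux ⟨22884⟩ OPEN (blocked-on ⟨19935⟩); the Yang–Mills mass gap is NOT proved; no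
summit is proved by a line.  THEOREMS ONLY (0 `def`, 0 `sorry`), standard axioms.  Width seat ym-line-sfw-p2-w3 g66 (cell ym-idea-1, free hands),
`--supports stmt-QuantumFields-24197`.  References: [folklore].
-/

set_option autoImplicit false

noncomputable section

open Quaternion
open scoped Quaternion RealInnerProductSpace
open Literature.MathematicalPhysics.QuantumFieldTheory.DybalskiStottmeisterTanimoto2024.DST24CriticalPoint (inner_eq_components)
open Summit.QuantumFields.YangMills.Theorems.SwapTwistDeficit.ToronLog (norm_comm_sq)
open Literature.MathematicalPhysics.QuantumLattice (sq_norm_eq_sum_sq)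

namespace Summit.QuantumFields.YangMills.Theorems.SwapVirialDeficit.NearFlat

/-- ★ Lagrange: `‖pq − qp‖² = 4·(‖im p‖²‖im q‖² − ⟨im p, im q⟩²)`. [folklore] -/
theorem norm_comm_sq_lagrange (p q : ℍ) : ‖p * q - q * p‖ ^ 2 = 4 * (‖p.im‖ ^ 2 * ‖q.im‖ ^ 2 - ⟪p.im, q.im⟫ ^ 2) := by
  rw [norm_comm_sq, sq_norm_eq_sum_sq, sq_norm_eq_sum_sq, inner_eq_components]
  simp only [Quaternion.re_im, Quaternion.imI_im, Quaternion.imJ_im, Quaternion.imK_im]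
  ring

/-- ★ The squared distance from `im q` to its projection on the axis `ℝ·im p`: `‖im q − t₀·im p‖² = ‖pq − qp‖²/(4‖im p‖²)`, `t₀ = ⟨im p, im q⟩/‖im p‖²`. [folklore] -/
theorem normSq_im_sub_proj {p : ℍ} (hp : p.im ≠ 0) (q : ℍ) :
    ‖q.im - (⟪p.im, q.im⟫ / ‖p.im‖ ^ 2) • p.im‖ ^ 2 = ‖p * q - q * p‖ ^ 2 / (4 * ‖p.im‖ ^ 2) := by
  have hp2 : 0 < ‖p.im‖ ^ 2 := by positivity
  rw [norm_comm_sq_lagrange, @norm_sub_sq_real, norm_smul, mul_pow, Real.norm_eq_abs, sq_abs, inner_smul_right, real_inner_comm]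
  field_simp
  ring

/-- For a vector `v` and a nonzero `w`, rescaling `w` to length `‖v‖` stays within `2‖v − w‖` of `v`. [folklore] -/
theorem norm_sub_rescale_le {E : Type*} [NormedAddCommGroup E] [NormedSpace ℝ E] (v : E) {w : E} (hw : w ≠ 0) :
    ‖v - (‖v‖ / ‖w‖) • w‖ ≤ 2 * ‖v - w‖ := by
  have hw0 : 0 < ‖w‖ := norm_pos_iff.2 hw
  have h1 : ‖w - (‖v‖ / ‖w‖) • w‖ = |‖w‖ - ‖v‖| := by
    have e : w - (‖v‖ / ‖w‖) • w = ((‖w‖ - ‖v‖) / ‖w‖) • w := by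
      rw [sub_div, div_self hw0.ne', sub_smul, one_smul]
    rw [e, norm_smul, Real.norm_eq_abs, abs_div, abs_of_pos hw0, div_mul_cancel₀ _ hw0.ne']
  calc ‖v - (‖v‖ / ‖w‖) • w‖ = ‖(v - w) + (w - (‖v‖ / ‖w‖) • w)‖ := by congr 1; abel
    _ ≤ ‖v - w‖ + ‖w - (‖v‖ / ‖w‖) • w‖ := norm_add_le _ _
    _ = ‖v - w‖ + |‖w‖ - ‖v‖| := by rw [h1]
    _ ≤ ‖v - w‖ + ‖v - w‖ := by
        have := abs_norm_sub_norm_le w v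
        rw [norm_sub_rev w v] at this
        linarith
    _ = 2 * ‖v - w‖ := by ring

/-- A quaternion with prescribed real part and an imaginary part proportional to `im p` commutes with `p`. [folklore] -/
theorem commute_of_coaxial (p : ℍ) (r t : ℝ) : p * ((r : ℍ) + t • p.im) = ((r : ℍ) + t • p.im) * p := by
  ext <;> simp <;> ring

/-- `‖↑r + v‖² = r² + ‖v‖²` for a pure-imaginary `v`. [folklore] -/
theorem norm_sq_coe_add_pure (r : ℝ) {v : ℍ} (hv : v.re = 0) : ‖(r : ℍ) + v‖ ^ 2 = r ^ 2 + ‖v‖ ^ 2 := by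
  rw [sq_norm_eq_sum_sq, sq_norm_eq_sum_sq v]
  simp [hv]
  ring

/-- ★★ **NEAR-COMMUTING ⟹ NEAR COAXIAL, with the Lipschitz constant `1/‖im p‖` of the heavy element**: for `im p ≠ 0` and any `q` there is `q′` with the same real part,
imaginary part on the axis `ℝ·im p` (so `p q′ = q′ p`), the same norm, and `‖q − q′‖ ≤ ‖pq − qp‖/‖im p‖`. [folklore] -/
theorem exists_coaxial_near {p : ℍ} (hp : p.im ≠ 0) (q : ℍ) :
    ∃ q' : ℍ, q'.re = q.re ∧ (∃ t : ℝ, q'.im = t • p.im) ∧ ‖q'‖ ^ 2 = ‖q‖ ^ 2 ∧ p * q' = q' * p ∧ ‖q - q'‖ ≤ ‖p * q - q * p‖ / ‖p.im‖ := by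
  have hpn : 0 < ‖p.im‖ := norm_pos_iff.2 hp
  -- the foot of the perpendicular
  set t₀ : ℝ := ⟪p.im, q.im⟫ / ‖p.im‖ ^ 2 with ht₀
  set w : ℍ := t₀ • p.im with hw
  have hdist : ‖q.im - w‖ ^ 2 = ‖p * q - q * p‖ ^ 2 / (4 * ‖p.im‖ ^ 2) := normSq_im_sub_proj hp q
  have hdist' : ‖q.im - w‖ = ‖p * q - q * p‖ / (2 * ‖p.im‖) := by
    have h1 : 0 ≤ ‖q.im - w‖ := norm_nonneg _
    have h2 : 0 ≤ ‖p * q - q * p‖ / (2 * ‖p.im‖) := by positivity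
    nlinarith [hdist, sq_nonneg (‖q.im - w‖ - ‖p * q - q * p‖ / (2 * ‖p.im‖)), sq_nonneg (‖q.im - w‖ + ‖p * q - q * p‖ / (2 * ‖p.im‖)),
      show (‖p * q - q * p‖ / (2 * ‖p.im‖)) ^ 2 = ‖p * q - q * p‖ ^ 2 / (4 * ‖p.im‖ ^ 2) by rw [div_pow]; ring]
  -- the rescaled imaginary part `v'`: on the axis, of length `‖im q‖`, within `2‖im q − w‖` of `im q`
  obtain ⟨s, hs_axis, hs_norm, hs_close⟩ : ∃ s : ℝ, True ∧ ‖s • p.im‖ = ‖q.im‖ ∧ ‖q.im - s • p.im‖ ≤ 2 * ‖q.im - w‖ := by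
    by_cases hw0 : w = 0
    · refine ⟨‖q.im‖ / ‖p.im‖, trivial, ?_, ?_⟩
      · rw [norm_smul, Real.norm_eq_abs, abs_of_nonneg (by positivity), div_mul_cancel₀ _ hpn.ne']
      · rw [hw0, sub_zero]
        calc ‖q.im - (‖q.im‖ / ‖p.im‖) • p.im‖ ≤ ‖q.im‖ + ‖(‖q.im‖ / ‖p.im‖) • p.im‖ := norm_sub_le _ _
          _ = 2 * ‖q.im‖ := by
              rw [norm_smul, Real.norm_eq_abs, abs_of_nonneg (by positivity), div_mul_cancel₀ _ hpn.ne']; ring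
    · refine ⟨‖q.im‖ / ‖w‖ * t₀, trivial, ?_, ?_⟩
      · have : (‖q.im‖ / ‖w‖ * t₀) • p.im = (‖q.im‖ / ‖w‖) • w := by rw [hw, smul_smul]
        rw [this, norm_smul, Real.norm_eq_abs, abs_of_nonneg (by positivity), div_mul_cancel₀ _ (norm_ne_zero_iff.2 hw0)]
      · have : (‖q.im‖ / ‖w‖ * t₀) • p.im = (‖q.im‖ / ‖w‖) • w := by rw [hw, smul_smul]
        rw [this]
        exact norm_sub_rescale_le q.im hw0
  -- the candidate
  refine ⟨(q.re : ℍ) + s • p.im, ?_, ⟨s, ?_⟩, ?_, commute_of_coaxial p q.re s, ?_⟩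
  · simp
  · ext <;> simp
  · rw [norm_sq_coe_add_pure q.re (by simp), hs_norm]
    have := sq_norm_eq_sum_sq q
    rw [this, sq_norm_eq_sum_sq q.im]
    simp
    ring
  · have e : q - ((q.re : ℍ) + s • p.im) = q.im - s • p.im := by
      rw [show q - ((q.re : ℍ) + s • p.im) = (q - (q.re : ℍ)) - s • p.im by abel, Quaternion.sub_re_self]
    rw [e]
    calc ‖q.im - s • p.im‖ ≤ 2 * ‖q.im - w‖ := hs_close
      _ = ‖p * q - q * p‖ / ‖p.im‖ := by rw [hdist']; field_simp

end Summit.QuantumFields.YangMills.Theorems.SwapVirialDeficit.NearFlat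

end
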